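import Summits.BirchSwinnertonDyer.Rank1Residual.O5.HeegnerLogTransportThreeHeegnerIndexEndCert
import Literature.NumberTheory.EllipticCurves.BSDHeegnerPointsModularityOnlyProofs
import HarnessLib
import HarnessLib.Audit.Tags

/-!
# Heegner-log transport at `p = 3` (KL3), part 28: the HEEGNER-INDEX END with the two Heegner-point
# non-torsion binders in ANALYTIC-RANK CURRENCY (`ord_{s=1} L(W/K, s) = ord_{s=1} L(G/K, s) = 1`, by
# the Gross–Zagier formula BY NAME, as in the two-sided ENDs) — o5-r2 GEN 29

HONEST FRAMING (cell `b2b-bsdres`, run/shared/lean/b2b/bsd-rank1-residual/, verbatim in every file): the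
team's routes on O5 ((t′): additive, potentially-supersingular reduction at an anomalous prime) are a
research route; **O5 stays OPEN**; every statement below is a theorem conditional on its displayed
hypotheses, or a definition; nothing is booked, no RESIDUAL-MAP mark / label / count / tier moves.

WHAT THIS FILE DOES (o5-r2 GEN 28 memo §G28-9 (iii); NO new mathematics about (t′)). The HEEGNER-INDEX END of
parts 27b/27c (`o5_index_unit_of_good_companion_heegnerIndex_ladder`) displays the non-torsion of the two Heegner
points `P_K ∈ W(K)`, `P′_K ∈ G(K)` as bare binders `hPinf : ¬ IsOfFinAddOrder P`, `hP′inf : ¬ IsOfFinAddOrder P′`.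
Gross–Zagier's theorem (Thm. I.6.3 with V.§2; Gross 1991, (1.1) "in particular, `y_K` has infinite order iff
`L′(E/K, 1) ≠ 0`") makes each of them EQUIVALENT to an analytic statement, and the tree carries exactly this
equivalence: the named fact **bsd.S16 (corollary)**
`Literature.NumberTheory.EllipticCurves.analyticRankEK_eq_one_iff_heegner_nonTorsion W N K`
(`ord_{s=1} L(E/K, s) = 1 ↔ P_K` non-torsion, for `W` globally minimal of conductor `N`, `K` imaginary quadratic with
the Heegner hypothesis for `N`, `P_K` a Heegner point of level `N`) is PROVED in the tree from the Gross–Zagier FORMULA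
`gross_zagier N W K` (bsd.S16) and modularity alone —
`BSDHeegnerPointsModularityOnlyProofs.analyticRankEK_eq_one_iff_heegner_nonTorsion_of_exists_isNewformOf`
(via `…GrossZagierProofs.analyticRankEK_eq_one_iff_heegner_nonTorsion_of_one_le` and
`one_le_analyticRankEK_of_exists_isNewformOf`: `L(E/K, 1) = 0` by the sign). This file re-displays the END in that
currency, with the SAME named-fact binder the two-sided ENDs of parts 25–27 already carry for `G` (`hGZG : gross_zagier N′ G K`):

`o5_index_unit_of_good_companion_heegnerIndex_ladder_analytic` — the binders `hPinf`, `hP′inf` are REPLACED by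
  * `hGZW : gross_zagier N W K`, `hGZG : gross_zagier N′ G K` (the Gross–Zagier formula BY NAME, for `W/K` at level `N`
    and for `G/K` at level `N′`; its printed antecedent "the parametrisation is at the conductor's level", `N = N_W`,
    `N′ = N_G`, is NOT a binder: it is DERIVED from modularity `hmod` and the newform carried by `D`, `D′` by the tree's
    Carayol-level theorem `IsNewformOf.level_eq_conductorNorm_of_exists_isNewformOf`, exactly as part 27 does), and
  * `han : analyticRankEK W K = 1`, `han′ : analyticRankEK G K = 1` — `ord_{s=1} L(W/K, s) = 1` and
    `ord_{s=1} L(G/K, s) = 1` (`analyticRankEK = r_an(E) + r_an(E^{(d_K)})`, bsd `analyticRankEK_eq_add`): the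
    ANALYTIC-RANK CURRENCY, checkable row by row by a root-number + central-value / derivative computation
    (EVIDENCE tier; for the rows of parts 27d/27e: `W`, `G` of analytic rank `1` over `ℚ` with `3`-congruent
    companions of rank `1`, and the twists by `d_K` of analytic rank `0` — o5-r2 GEN 16/28 census currencies).
  The Heegner points `P`, `P′` stay displayed through `hP`, `hP′` (they ARE Heegner points of levels `N`, `N′`:
  `IsHeegnerPoint N W K P = ∃ Dt H ι, P ↦ heegnerPointComplex Dt H`), so
  `analyticRankEK_eq_one_iff_heegner_nonTorsion_of_exists_isNewformOf W N K hGZW hmod hK _ hH ⟨D, H, ι, hP⟩ : r_an = 1 ↔ P ∉ tors`.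

What the END STILL DISPLAYS (honest list): Kriz–Li Thm. 1.16 (`hKL`), modularity (`hmod`), the Gross–Zagier formula
(`hGZW`, `hGZG`) BY NAME (its non-torsion corollary and Carayol's level theorem are tree THEOREMS given `hmod`); the
finitary binders of part 27c (kernel-decidable per row); the Heegner /
modular-parametrisation data; `han`, `han′`; the companion's Heegner index `hIdx : 3 ∤ [G(K) : ℤP′_K]`; the Manin
binders `hcD`, `hc3′`. Nothing about (t′) is claimed beyond this conditional implication.

References: [cite: KrizLi2019, Theorem 1.16 (arXiv:1609.06687v4 pp. 7-8)] [cite: GrossZagier1986, Thm. I.6.3 with V.§2]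
[cite: Gross1991, (1.1)] [cite: AtkinLehner1970, Thm. 4] [cite: DiamondShurman2005, Thm. 8.8.1] [cite: SilvermanAEC2009, IV.6.4, VII.2.2 and VIII.9.3(d)]

Typed by `planner-b2b-bsdres-o5-r2-g29-0` (o5-r2 GEN 29, part 28). Target path
`O5/HeegnerLogTransportThreeHeegnerIndexEndAnalytic.lean` (NEW leaf; imports part 27c `…HeegnerIndexEndCert` and
`Literature.NumberTheory.EllipticCurves.BSDHeegnerPoints`). THEOREMS ONLY. Nothing booked.

### cc-typer-5 GEN 20 (O5 §3.5 / O6 §3.4 typer of record) — by-name ask A-O5-G29-1 of o5-r2 GEN 29 (HOME/INBOX.md l.15286 close + P.S. 1 l.15310 + P.S. 2 l.15330; by sha,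
VERBATIM + ¶; memo gen29/O5-GEN29.md) item (d) part 28 REVISED f65ccf94b90b6288 (P.S. 1: supersedes bd152d3cf51eb962) → O5/HeegnerLogTransportThreeHeegnerIndexEndAnalytic.lean.
Source: `HOME/b2b-bsdres-o5-r2/gen29/lean/HeegnerLogTransportThreeHeegnerIndexEndAnalytic.lean` sha16 `f65ccf94b90b6288` (130 l.; `gen29/SHA16.txt`; o5-r2's farm checks rc 0 / 0
warnings / 0 sorries, axioms standard, dedup clean as stated in their line), re-hashed by the typer right before writing; THIS file = the source VERBATIM + this paragraph
(imports, module text, every declaration block byte-identical; script `class-closure/typer-5/gen20/gplace.py`, docstring anchor asserted); imports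
`O5.HeegnerLogTransportThreeHeegnerIndexEndCert`, `Literature.NumberTheory.EllipticCurves.BSDHeegnerPointsModularityOnlyProofs` — all in the tree at filing; the typer's own
standalone farm check on tree imports (rc 0 / 0 warnings / 0 sorries; `#print axioms` of the END(s) standard) and DEDUP (`lean search --decl` on the 2 new names: no match; the
gate's statement-level dedup at dry-run) precede the proposal. CONTENT LABELS: as the source's module text above states (declarations:
`o5_index_unit_of_good_companion_heegnerIndex_ladder_analytic`, `level_eq_of_conductorNorm_eq`); 0 `@[conjecture]`, 0 Literature facts (net named-fact debt 0), no `sorry`;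
published inputs stay displayed hypotheses BY NAME, nothing re-proved. HONEST FRAMING (cell `b2b-bsdres`): research route, lane CLASS-CLOSURE §3.5 O5; CONDITIONAL ENDs — nothing
asserted beyond the displayed binders, nothing booked, no mark / label / count / tier of `RESIDUAL-MAP.md` moves; census / instrument statements = EVIDENCE or displayed binders,
never a Literature fact; O5 OPEN.
-/

noncomputable section

open scoped Classical

open WeierstrassCurve Literature.NumberTheory.EllipticCurves
  Literature.NumberTheory.EllipticCurves.ModularForms
  Literature.NumberTheory.EllipticCurves.Rank1Residual
  Literature.NumberTheory.EllipticCurves.Rank1Residual.Typed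
open Summit.BirchSwinnertonDyer.Rank1Residual.Additive.LocalLog
open IsDedekindDomain (HeightOneSpectrum)
open scoped NumberField

namespace Summit.BirchSwinnertonDyer.Rank1Residual.O5.HeegnerLogTransport

/-- **THE HEEGNER-INDEX END IN ANALYTIC-RANK CURRENCY** (part 27c's `o5_index_unit_of_good_companion_heegnerIndex_ladder`
with `hPinf`, `hP′inf` supplied by the Gross–Zagier formula BY NAME + analytic rank `1` over `K`). For `W` additive at `3` with
`ρ̄_{W,3}` onto and a `3`-congruent companion `G` of GOOD reduction at `3` (ordinary or supersingular), modular
parametrisations of levels `N`, `N′` (`= N_W`, `N_G` by modularity + Carayol, derived), an imaginary quadratic `K` (`d_K < −4`, Heegner for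
`N`, `N′`, `3`) and Heegner points `P ∈ W(K)`, `P′ ∈ G(K)` of levels `N`, `N′`: GIVEN Kriz–Li Thm. 1.16, modularity and
Gross–Zagier (`gross_zagier`, for `W/K` and for `G/K`) BY NAME, the finitary binders, the kernel ladder
certificate of the unit-log side condition, `ord_{s=1} L(W/K, s) = 1`, `ord_{s=1} L(G/K, s) = 1`, the companion's
Heegner index `3 ∤ [G(K) : ℤP′_K]` and the Manin units, the HEEGNER INDEX OF `W` IS A `3`-ADIC UNIT:
`ord₃ [W(K) : ℤ P_K] = 0`. Conditional theorem; research route; O5 OPEN; nothing booked.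
[cite: KrizLi2019, Theorem 1.16 (arXiv:1609.06687v4 pp. 7-8)] [cite: GrossZagier1986, Thm. I.6.3 with V.§2]
[cite: Gross1991, (1.1)] [cite: SilvermanAEC2009, IV.6.4, VII.2.2 and VIII.9.3(d)] -/
theorem o5_index_unit_of_good_companion_heegnerIndex_ladder_analytic
    (hKL : KrizLi2019.thm116_padicLogHeegner_congruence) (hmod : exists_isNewformOf)
    (W G : WeierstrassCurve ℚ) [W.IsElliptic] [W.IsGloballyMinimal] [G.IsElliptic] [G.IsGloballyMinimal]
    (hcong : ∀ ℓ : ℕ, ℓ.Prime → ¬ (ℓ ∣ 3 * W.conductorNorm ℤ * G.conductorNorm ℤ) →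
      ((W.LFunction ℓ : ℤ) : ZMod 3) = ((G.LFunction ℓ : ℤ) : ZMod 3))
    (hρ : W.HasSurjectiveModNGaloisRep 3) (hadd : Addv W 3)
    (hunitW : ∀ ℓ ∈ klSet W G, ℓ ≠ 3 → padicValInt 3 (nsCount W ℓ) = 0)
    (hunitG : ∀ ℓ ∈ klSet G W, ℓ ≠ 3 → padicValInt 3 (nsCount G ℓ) = 0)
    (htam : ¬ 3 ∣ W.tamagawaProduct) (hgoodG : G.HasGoodReductionAtPrime 3)
    {N N' : ℕ} [NeZero N] [NeZero N']
    (D : ModularParametrizationData W N) (D' : ModularParametrizationData G N')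
    (K : Type) [Field K] [NumberField K] (hK : IsImaginaryQuadratic K)
    (hGZW : gross_zagier N W K) (hGZG : gross_zagier N' G K)
    (hH : SatisfiesHeegnerHypothesis N K) (hH' : SatisfiesHeegnerHypothesis N' K)
    (h3K : SatisfiesHeegnerHypothesis 3 K) (hd : NumberField.discr K < -4)
    (H : HeegnerDatum N (NumberField.discr K)) (H' : HeegnerDatum N' (NumberField.discr K))
    (ι : K →+* ℂ) (ι₃ : K →+* ℚ_[3])
    (P : (W.baseChange K).toAffine.Point) (P' : (G.baseChange K).toAffine.Point)
    (hP : WeierstrassCurve.Affine.Point.map ι.toRatAlgHom P = heegnerPointComplex D H)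
    (hP' : WeierstrassCurve.Affine.Point.map ι.toRatAlgHom P' = heegnerPointComplex D' H')
    (han : analyticRankEK W K = 1) (han' : analyticRankEK G K = 1)
    {x₀ y₀ xf yf : ℚ} (h₀ : G.toAffine.Nonsingular x₀ y₀) (steps : List Supersingular.QStep)
    (hrun : Supersingular.ladderRunQ G.a₁ G.a₂ G.a₃ G.a₄ x₀ y₀ x₀ y₀ steps = some (xf, yf))
    {k : ℕ} (hk : 0 < k) (hx : padicValRat 3 xf = -(2 * (k : ℤ)))
    (hmk : (k : ℤ) - padicValNat 3 (Supersingular.qScalar 1 steps) + padicValInt 3 (nsCount G 3) - 1 = 0)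
    (hIdx : ¬ 3 ∣ (AddSubgroup.zmultiples P').index)
    (hcD : padicValInt 3 D.maninConstant = 0) (hc3' : ¬ ((3 : ℤ) ∣ D'.maninConstant)) :
    padicValNat 3 (AddSubgroup.zmultiples P).index = 0 :=
  o5_index_unit_of_good_companion_heegnerIndex_ladder hKL hmod W G hcong hρ hadd hunitW hunitG htam hgoodG
    D D' K hK hH hH' h3K hd H H' ι ι₃ P P' hP hP'
    ((analyticRankEK_eq_one_iff_heegner_nonTorsion_of_exists_isNewformOf W N K hGZW hmod hK
      (IsNewformOf.level_eq_conductorNorm_of_exists_isNewformOf hmod D.isNewformOf).symm hH ⟨D, H, ι, hP⟩).mp han)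
    ((analyticRankEK_eq_one_iff_heegner_nonTorsion_of_exists_isNewformOf G N' K hGZG hmod hK
      (IsNewformOf.level_eq_conductorNorm_of_exists_isNewformOf hmod D'.isNewformOf).symm hH' ⟨D', H', ι, hP'⟩).mp han')
    h₀ steps hrun hk hx hmk hIdx hcD hc3'

/-- **The parametrisation level is forced** (bookkeeping, for the row files): given modularity `hmod`, a modular
parametrisation datum `D : ModularParametrizationData W N` carries a newform of level `N` with `W`'s eigenvalues, so
`N = N_W` (Carayol's level theorem in the tree, `IsNewformOf.level_eq_conductorNorm_of_exists_isNewformOf`) and hence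
`N` equals any certified conductor numeral `c = N_W`. [cite: AtkinLehner1970, Thm. 4] [cite: DiamondShurman2005, Thm. 8.8.1] -/
theorem level_eq_of_conductorNorm_eq (hmod : exists_isNewformOf) {W : WeierstrassCurve ℚ} [W.IsElliptic]
    {N : ℕ} [NeZero N] (D : ModularParametrizationData W N) {c : ℕ} (hc : W.conductorNorm ℤ = c) : N = c :=
  (IsNewformOf.level_eq_conductorNorm_of_exists_isNewformOf hmod D.isNewformOf).trans hc

end Summit.BirchSwinnertonDyer.Rank1Residual.O5.HeegnerLogTransport

end
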